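import Summits.ValiantsHypothesis.ValiantsHypothesis.Theses.ShallowShadows
import HarnessLib

/-!
# Route ShallowShadows — the assembly item (stmt-ValiantsHypothesis-17132)

The route's `Assembly` is `ShadowFormulaTransfer → RazWigdersonMatching → PerShadow → PerZeroOne →
TransferKillsPer → ValiantsHypothesis`; the route file's deciding theorem `closes` already derives
`ValiantsHypothesis` from the first two hypotheses, so the assembly is the bookkeeping implication
(candidate proof attached to the item by grounder g79-3 and refuter review 2026-08-16/17, landed here).
Honest framing: this closes the ASSEMBLY item only — the crux `ShadowFormulaTransfer`
(stmt-ValiantsHypothesis-17124) stays OPEN, and nothing here is progress on VP ≠ VNP.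
-/

-- The conventional Theorems namespace repeats the summit name (single-conjunct summit); lint debt noted.
set_option linter.dupNamespace false

namespace Summit.ValiantsHypothesis.ValiantsHypothesis.Theorems.ShallowShadowsAssemblyProof

open Summit.ValiantsHypothesis.ValiantsHypothesis.Theses.ShallowShadows

/-- **Assembly of route ShallowShadows** (item stmt-ValiantsHypothesis-17132): the five route items
imply `ValiantsHypothesis`, by the route's deciding theorem `closes` (which uses only
`ShadowFormulaTransfer` and `RazWigdersonMatching`). [folklore] -/
theorem assembly_proof : Summit.ValiantsHypothesis.ValiantsHypothesis.Theses.ShallowShadows.Assembly :=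
  fun h1 hRW _ _ _ => closes h1 hRW

end Summit.ValiantsHypothesis.ValiantsHypothesis.Theorems.ShallowShadowsAssemblyProof
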